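import Mathlib
import HarnessLib
import Summits.ResolutionOfSingularities.ResolutionOfSingularities.Theorems.HomologicalConductorPersistencePeriodicSaturation
import Summits.ResolutionOfSingularities.ResolutionOfSingularities.Theorems.HomologicalConductorPersistenceConductorCeiling
import Summits.ResolutionOfSingularities.ResolutionOfSingularities.Theorems.HomologicalConductorPersistenceConductorStable

/-!
# `ca(R) = 𝔠` EXACTLY: rings with saturation `ca = caⁿ` (`n ≤ 3`) and a principal-ideal overring —
# hypersurface curves with PID normalisation

Route `ResolutionOfSingularities/HomologicalConductor`, chain W4.4b, rung S-2 `PersistenceSurface`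
(stmt-ResolutionOfSingularities-19970): the curve side of the cA-arena enabling formula («`ca(C_h) = 𝔠(h)`», tri-1
CA-CURVE) and the Σ8 cell; seat res-L1-w44b-stub-2 (gen 5), row «Ω-recurrence certificates — kernel shape»
(periodic = recurrent case).  [OURS · L1 w44b; AI-written, weaker than expert review; NOT a statement of the
manuscript under study (Hironaka 2017), and no statement of that manuscript is used.]

Composes three tree results: PERIODIC SATURATION (`…PersistencePeriodicSaturation.cohomologyAnnihilator_eq_of_powerBasis`,
res-type-011: `ca(R) = caᵈ⁺¹(R)` for `R` with a power basis over a noetherian `S` with `caᵈ⁺¹(S) = S`), the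
CONDUCTOR CEILING (`…PersistenceConductorCeiling.cohomologyAnnihilatorOfDegree_three_le_conductor`, res-L1-w44b-lead-1
p550697: `ca³(R) ⊆ 𝔠`; its hypersurface all-level form is lead-1's `cohomologyAnnihilator_le_conductor_of_isRegularHypersurfaceQuotient`,
p554496) and the PID CONDUCTOR FLOOR (`…PersistenceConductorStable.mem_cohomologyAnnihilatorOfDegree_two_of_conductor`,
res-L1-w44b-stub-2 p532769: `c·C ⊆ R`, `C` a PID ⇒ `c ∈ ca²(R)`).

Results (`R` a noetherian domain with fraction field `K`; the overring `C` an `R`-subalgebra of `K`, module-finite;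
`𝔠 = {r | r·C ⊆ R}`):

* `cohomologyAnnihilator_le_conductor_of_eq_cohomologyAnnihilatorOfDegree` — `ca(R) = caⁿ(R)` for some `n ≤ 3`
  (saturation) ⇒ `ca(R) ⊆ 𝔠` at all levels (Submodule form, as p550697);
* `conductor_le_cohomologyAnnihilatorOfDegree_two` — `C` a principal ideal ring ⇒ `𝔠 ⊆ ca²(R)` (route vocabulary);
* **`cohomologyAnnihilator_eq_conductor_of_eq_cohomologyAnnihilatorOfDegree`** — both ⇒ `ca(R) = 𝔠`;
* **`cohomologyAnnihilator_eq_conductor_of_powerBasis`** / `cohomologyAnnihilatorOfDegree_eq_conductor_of_powerBasis` /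
  `cohomologyAnnihilator_eq_conductor_adjoinRoot_of_isRegularRing` — `R` with a power basis over `S` with
  `caᵈ⁺¹(S) = S`, `d ≤ 2` (e.g. `R = S[z]/(g)` a domain, `g` monic, `S` regular of dimension `≤ 2`), `C` a PID ⇒
  **`ca(R) = caⁿ(R) = 𝔠` for every `n ≥ 2`** (then `C` is the normalisation).  For `S` a DVR or `k[t]` this is the
  abstract skeleton of «the cohomology annihilator of a curve is its conductor» ([Esentepe2020, Thm 4.4] for
  reduced complete Gorenstein curves; the tree's NAMED FACT `planeCurve_cohomologyAnnihilator_eq_conductor` is NOT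
  discharged here — its statement quantifies over all reduced `h ∈ k⟦z,t⟧` and needs the normalisation of
  `k⟦z,t⟧/(h)`; this file proves the equality from the power basis and an explicitly given PID overring, fact-free).

References (mechanism only): S. B. Iyengar, R. Takahashi, IMRN 2016 §2 [`IyengarTakahashi2014`]; Ö. Esentepe,
J. Algebra 541 (2020), arXiv:1807.05471, Thm 4.4 [`Esentepe2020`] (statement shape only; not used as a premise).
-/

noncomputable section

-- single-problem summit: the doubled namespace component `ResolutionOfSingularities` is forced
set_option linter.dupNamespace false

namespace Summit.ResolutionOfSingularities.ResolutionOfSingularities.Theorems.HomologicalConductor.ConductorExact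

open Literature.RingTheory.CohomologyAnnihilator
open scoped nonZeroDivisors
open Summit.ResolutionOfSingularities.ResolutionOfSingularities.Theorems.HomologicalConductor.PeriodicSaturation
open Summit.ResolutionOfSingularities.ResolutionOfSingularities.Theorems.HomologicalConductor.PersistenceConductorCeiling
open Summit.ResolutionOfSingularities.ResolutionOfSingularities.Theorems.HomologicalConductor.ConductorStable

universe u

variable {R : Type u} [CommRing R] [IsDomain R] [IsNoetherianRing R] {K : Type u} [Field K] [Algebra R K]
  [IsFractionRing R K]

/-! ## The ceiling at all levels for rings with saturation `ca = ca³` -/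

/-- **Ceiling at all levels from saturation at level `≤ 3`**: if `ca(R) = caⁿ(R)` for some `n ≤ 3`, then
`ca(R) ⊆ 𝔠` for every module-finite birational overring. [folklore] -/
theorem cohomologyAnnihilator_le_conductor_of_eq_cohomologyAnnihilatorOfDegree {n : ℕ} (hn : n ≤ 3)
    (hsat : cohomologyAnnihilator R = cohomologyAnnihilatorOfDegree R n) (M : Submodule R K)
    (hM1 : (1 : K) ∈ M) (hMmul : ∀ a ∈ M, ∀ b ∈ M, a * b ∈ M) (hMfg : M.FG) (𝔠 : Ideal R)
    (h𝔠 : ∀ r : R, r ∈ 𝔠 ↔ ∀ m ∈ M, ∃ r' : R, algebraMap R K r' = algebraMap R K r * m) :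
    cohomologyAnnihilator R ≤ 𝔠 := by
  intro x hx
  rw [hsat] at hx
  exact cohomologyAnnihilatorOfDegree_three_le_conductor M hM1 hMmul hMfg 𝔠 h𝔠
    (cohomologyAnnihilatorOfDegree_mono hn hx)

/-! ## The floor when the overring is a principal ideal ring, and the exact conductor formula -/

/-- **Conductor floor for a principal-ideal overring** (route vocabulary): for an `R`-subalgebra `C` of `K = Frac R`
that is a principal ideal ring, the conductor `𝔠 = {r | r·C ⊆ R}` lies in `ca²(R)` (p532769 on `R ↪ C`). [folklore] -/
theorem conductor_le_cohomologyAnnihilatorOfDegree_two (C : Subalgebra R K) [IsPrincipalIdealRing ↥C]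
    (𝔠 : Ideal R) (h𝔠 : ∀ r : R, r ∈ 𝔠 ↔ ∀ m ∈ C, ∃ r' : R, algebraMap R K r' = algebraMap R K r * m) :
    𝔠 ≤ cohomologyAnnihilatorOfDegree R 2 := by
  intro c hc
  have hinj : Function.Injective (algebraMap R ↥C) := by
    intro a b hab
    apply IsFractionRing.injective R K
    have := congrArg (fun z : ↥C => (z : K)) hab
    simpa using this
  refine mem_cohomologyAnnihilatorOfDegree_two_of_conductor (D := ↥C) hinj fun m => ?_
  obtain ⟨c', hc'⟩ := (h𝔠 c).mp hc m m.2
  exact ⟨c', Subtype.ext (by simpa using hc')⟩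

/-- **`ca(R) = 𝔠` EXACTLY** for a noetherian domain `R` with `ca(R) = caⁿ(R)` for some `n ≤ 3` and a module-finite
birational overring `C ≤ K` which is a principal ideal ring (e.g. the normalisation of a curve germ when it is a
DVR / of an affine curve when it is a PID). [folklore] -/
theorem cohomologyAnnihilator_eq_conductor_of_eq_cohomologyAnnihilatorOfDegree {n : ℕ} (hn : n ≤ 3)
    (hsat : cohomologyAnnihilator R = cohomologyAnnihilatorOfDegree R n) (C : Subalgebra R K)
    [IsPrincipalIdealRing ↥C] (hCfg : (Subalgebra.toSubmodule C).FG) (𝔠 : Ideal R)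
    (h𝔠 : ∀ r : R, r ∈ 𝔠 ↔ ∀ m ∈ C, ∃ r' : R, algebraMap R K r' = algebraMap R K r * m) :
    cohomologyAnnihilator R = 𝔠 := by
  refine le_antisymm ?_ ((conductor_le_cohomologyAnnihilatorOfDegree_two C 𝔠 h𝔠).trans
    (cohomologyAnnihilatorOfDegree_le 2))
  exact cohomologyAnnihilator_le_conductor_of_eq_cohomologyAnnihilatorOfDegree hn hsat (Subalgebra.toSubmodule C)
    C.one_mem (fun a ha b hb => C.mul_mem ha hb) hCfg 𝔠 (fun r => h𝔠 r)

section PowerBasis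

variable {S : Type u} [CommRing S] [IsNoetherianRing S] [Algebra S R]

/-- **`ca(R) = 𝔠` for hypersurface rings with a PID overring.** `R` a noetherian domain with a power basis over a
noetherian `S` with `caᵈ⁺¹(S) = S`, `d ≤ 2`; `C ≤ Frac R` a module-finite `R`-subalgebra which is a principal ideal
ring; `𝔠` its conductor.  Then `ca(R) = 𝔠`.  (Hypersurface curve germs / affine plane curves monic in one variable
with PID normalisation: «the cohomology annihilator of the curve is its conductor».) [folklore] -/
theorem cohomologyAnnihilator_eq_conductor_of_powerBasis (pb : PowerBasis S R) {d : ℕ} (hd : d ≤ 2)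
    (hvan : cohomologyAnnihilatorOfDegree S (d + 1) = ⊤) (C : Subalgebra R K) [IsPrincipalIdealRing ↥C]
    (hCfg : (Subalgebra.toSubmodule C).FG) (𝔠 : Ideal R)
    (h𝔠 : ∀ r : R, r ∈ 𝔠 ↔ ∀ m ∈ C, ∃ r' : R, algebraMap R K r' = algebraMap R K r * m) :
    cohomologyAnnihilator R = 𝔠 :=
  cohomologyAnnihilator_eq_conductor_of_eq_cohomologyAnnihilatorOfDegree (by omega)
    (cohomologyAnnihilator_eq_of_powerBasis pb hvan) C hCfg 𝔠 h𝔠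

/-- Levelled: under the same hypotheses `caⁿ(R) = 𝔠` for every `n ≥ 2` (and `ca⁰ ⊆ ca¹ ⊆ 𝔠`). [folklore] -/
theorem cohomologyAnnihilatorOfDegree_eq_conductor_of_powerBasis (pb : PowerBasis S R) {d : ℕ} (hd : d ≤ 2)
    (hvan : cohomologyAnnihilatorOfDegree S (d + 1) = ⊤) (C : Subalgebra R K) [IsPrincipalIdealRing ↥C]
    (hCfg : (Subalgebra.toSubmodule C).FG) (𝔠 : Ideal R)
    (h𝔠 : ∀ r : R, r ∈ 𝔠 ↔ ∀ m ∈ C, ∃ r' : R, algebraMap R K r' = algebraMap R K r * m)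
    {n : ℕ} (hn : 2 ≤ n) : cohomologyAnnihilatorOfDegree R n = 𝔠 := by
  refine le_antisymm ((cohomologyAnnihilatorOfDegree_le n).trans
    (cohomologyAnnihilator_eq_conductor_of_powerBasis pb hd hvan C hCfg 𝔠 h𝔠).le) ?_
  exact (conductor_le_cohomologyAnnihilatorOfDegree_two C 𝔠 h𝔠).trans (cohomologyAnnihilatorOfDegree_mono hn)

end PowerBasis

/-- **`ca(S[z]/(f)) = 𝔠` over a regular base of dimension `≤ 2`** with a PID overring (`f` monic, `S[z]/(f)` a
domain). [folklore] -/
theorem cohomologyAnnihilator_eq_conductor_adjoinRoot_of_isRegularRing {S : Type u} [CommRing S] [IsRegularRing S]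
    (hdS : ringKrullDim S ≤ 2) {f : Polynomial S} (hf : f.Monic) [IsDomain (AdjoinRoot f)]
    [IsNoetherianRing (AdjoinRoot f)] {K : Type u} [Field K] [Algebra (AdjoinRoot f) K]
    [IsFractionRing (AdjoinRoot f) K] (C : Subalgebra (AdjoinRoot f) K) [IsPrincipalIdealRing ↥C]
    (hCfg : (Subalgebra.toSubmodule C).FG) (𝔠 : Ideal (AdjoinRoot f))
    (h𝔠 : ∀ r : AdjoinRoot f, r ∈ 𝔠 ↔
      ∀ m ∈ C, ∃ r' : AdjoinRoot f, algebraMap (AdjoinRoot f) K r' = algebraMap (AdjoinRoot f) K r * m) :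
    cohomologyAnnihilator (AdjoinRoot f) = 𝔠 :=
  cohomologyAnnihilator_eq_conductor_of_eq_cohomologyAnnihilatorOfDegree le_rfl
    (cohomologyAnnihilator_adjoinRoot_eq_of_isRegularRing (d := 2) (by exact_mod_cast hdS) hf) C hCfg 𝔠 h𝔠

end Summit.ResolutionOfSingularities.ResolutionOfSingularities.Theorems.HomologicalConductor.ConductorExact

end
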